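import Literature.NumberTheory.Transcendental.KZDirichletCharts
import Literature.NumberTheory.Transcendental.KZProductIdeal

/-!
# `MultiplicationAccessible` (stmt-KontsevichZagierPeriods-12305), line `shifted-family-prime-sieve`,
stub `stub_betaReassoc`

DIRICHLET RE-ASSOCIATION `B(a,b)·B(a+b,c) = B(b,c)·B(a,b+c)` (Andrews–Askey–Roy 1999, Thm 1.8.1)
as an equivalence, in the Kontsevich–Zagier calculus of moves, between the two pinned Beta boxes
`r  = [(0,1)², u^{a-1}(1-u)^{b-1} · v^{a+b-1}(1-v)^{c-1}]` and
`r' = [(0,1)², t^{b-1}(1-t)^{c-1} · u^{a-1}(1-u)^{b+c-1}]`.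

Chain of moves (three changes of variables): the coordinate swap of `r`
(`KZ.of_sub_of_reindex_mem_relations` along `Equiv.swap 0 1`) is the box representation `P` of
the polar chart of the Dirichlet simplex `[Δ, x^{a-1}y^{b-1}(1-x-y)^{c-1}]`
(`KZ.dirichletPolar_equivalent`), and `r'` is the box representation of its linear chart
(`KZ.dirichletLinear_equivalent`).

References: Kontsevich–Zagier 2001 §1.2 (rule (2)); Andrews–Askey–Roy 1999 Thm 1.8.1.
-/

noncomputable section

open MeasureTheory Set
open Literature.NumberTheory.Transcendental
open Literature.NumberTheory.Transcendental.KZ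

namespace Summit.KontsevichZagierPeriods.TerasomaMultiplication.MultiplicationAccessible

namespace BetaReassoc

/-- The open box `(0,1)²`: the `∀ i` spelling equals the coordinate spelling. [folklore] -/
theorem box2_forall_eq :
    {z : Fin 2 → ℝ | ∀ i, z i ∈ Set.Ioo (0:ℝ) 1} =
      {z | z 0 ∈ Set.Ioo (0:ℝ) 1 ∧ z 1 ∈ Set.Ioo (0:ℝ) 1} := by
  ext z
  simp only [mem_setOf_eq, Fin.forall_fin_two]

/-- The coordinate swap of a representation pinned on the box `(0,1)²` is pinned on the box
`(0,1)²` (coordinate spelling). [folklore] -/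
theorem swap_domain_eq (r : IntegralRep 2) (hrd : r.domain = {z | ∀ i, z i ∈ Set.Ioo (0:ℝ) 1}) :
    (r.reindex (Equiv.swap (0 : Fin 2) 1)).domain =
      {z | z 0 ∈ Set.Ioo (0:ℝ) 1 ∧ z 1 ∈ Set.Ioo (0:ℝ) 1} := by
  ext z
  simp only [IntegralRep.reindex_domain, hrd, mem_setOf_eq, Fin.forall_fin_two,
    Equiv.swap_apply_left, Equiv.swap_apply_right]
  exact and_comm

end BetaReassoc

open BetaReassoc in
/-- **Dirichlet re-association** `B(a,b)B(a+b,c) = B(b,c)B(a,b+c)` as an equivalence of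
2-dimensional Beta boxes: swap the coordinates of `r` (a change of variables,
`KZ.of_sub_of_reindex_mem_relations`), pass to the Dirichlet simplex
`[Δ, x^{a-1}y^{b-1}(1-x-y)^{c-1}]` by the polar chart (`KZ.dirichletPolar_equivalent`) and back to
the box `r'` by the linear chart (`KZ.dirichletLinear_equivalent`).
[cite: AndrewsAskeyRoy1999, Thm 1.8.1] -/
theorem stub_betaReassoc :
    ∀ (a b c : ℚ), 0 < a → 0 < b → 0 < c → ∀ (r r' : KZ.IntegralRep 2),
      r.domain = {z | ∀ i, z i ∈ Set.Ioo (0:ℝ) 1} →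
      Set.EqOn r.integrand (fun z => (z 0) ^ ((a:ℝ) - 1) * (1 - z 0) ^ ((b:ℝ) - 1) *
        ((z 1) ^ ((a:ℝ) + (b:ℝ) - 1) * (1 - z 1) ^ ((c:ℝ) - 1))) r.domain →
      r'.domain = {z | ∀ i, z i ∈ Set.Ioo (0:ℝ) 1} →
      Set.EqOn r'.integrand (fun z => (z 0) ^ ((b:ℝ) - 1) * (1 - z 0) ^ ((c:ℝ) - 1) *
        ((z 1) ^ ((a:ℝ) - 1) * (1 - z 1) ^ ((b:ℝ) + (c:ℝ) - 1))) r'.domain →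
      KZ.Equivalent r r' := by
  intro a b c _ _ _ r r' hrd hri hr'd hr'i
  -- (1) the coordinate swap `P` of `r` is one change of variables away from `r`
  have hrP : KZ.Equivalent r (r.reindex (Equiv.swap (0 : Fin 2) 1)) :=
    KZ.of_sub_of_reindex_mem_relations r _
  -- `P` is the box representation of the polar chart
  have hPi : Set.EqOn (r.reindex (Equiv.swap (0 : Fin 2) 1)).integrand
      (fun z => (z 0) ^ ((a:ℝ) + b - 1) * (1 - z 0) ^ ((c:ℝ) - 1) *
        ((z 1) ^ ((a:ℝ) - 1) * (1 - z 1) ^ ((b:ℝ) - 1)))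
      (r.reindex (Equiv.swap (0 : Fin 2) 1)).domain := by
    intro z hz
    have hz' : (fun i => z (Equiv.swap (0 : Fin 2) 1 i)) ∈ r.domain := hz
    rw [IntegralRep.reindex_integrand]
    dsimp only
    rw [hri hz']
    simp only [Equiv.swap_apply_left, Equiv.swap_apply_right]
    ring
  -- (2) polar chart onto the Dirichlet simplex, (3) linear chart back to the box `r'`
  obtain ⟨S, hSd, hSi, hPS⟩ :=
    KZ.dirichletPolar_equivalent a b c _ (swap_domain_eq r hrd) hPi
  have hSr' : KZ.Equivalent S r' :=
    KZ.dirichletLinear_equivalent a b c S r' hSd hSi (by rw [hr'd, box2_forall_eq]) hr'i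
  exact hrP.trans (hPS.trans hSr')

end Summit.KontsevichZagierPeriods.TerasomaMultiplication.MultiplicationAccessible
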